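import Summits.NavierStokesRegularity.NavierStokesRegularity.Theorems.PerpetualPumpAveragedTypeIBlowupLinearComparison

/-!
# Crux `PerpetualPump.AveragedTypeIBlowup` (stmt-NavierStokesRegularity-1835), line `Sketch`: rescaling one mode of the
# critical Toda system to the slow time of the front (lead c1 assembly tool)
-/

noncomputable section
set_option linter.dupNamespace false

open Set MeasureTheory Filter Topology intervalIntegral

namespace Summit.NavierStokesRegularity.NavierStokesRegularity.Theorems.PerpetualPumpAveragedTypeIBlowup

/-- **One mode in slow time.** A `C¹` mode `x` of the critical system on real time `[0,T]` with rate `Rk`,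
model right-hand side `Rk·g` and error `≤ η Rk M`, read in the slow time `σ = Rn (t − t₀)` of the front
(`0 ≤ t₀`, `t₀ + σ₁/Rn ≤ T`): the rescaled mode `σ ↦ x(t₀ + σ/Rn)` is continuous on `[0,σ₁]`, and on `(0,σ₁)` it has
derivative `(Rk/Rn)·g + e` with a CONTINUOUS error `e`, `|e| ≤ η (Rk/Rn) M`. [folklore] -/
theorem rescale_mode :
    ∀ {x dx g M : ℝ → ℝ} {t₀ Rn Rk T σ₁ η : ℝ}, 0 < Rn → 0 ≤ t₀ → 0 ≤ σ₁ → t₀ + σ₁ / Rn ≤ T →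
      ContinuousOn x (Icc 0 T) → ContinuousOn dx (Icc 0 T) → ContinuousOn g (Icc 0 T) →
      ContinuousOn M (Icc 0 T) →
      (∀ t ∈ Ioo 0 T, HasDerivAt x (dx t) t ∧ |dx t - Rk * g t| ≤ η * Rk * M t) →
      ContinuousOn (fun σ : ℝ => x (t₀ + σ / Rn)) (Icc 0 σ₁) ∧
      ContinuousOn (fun σ : ℝ => (dx (t₀ + σ / Rn) - Rk * g (t₀ + σ / Rn)) / Rn) (Icc 0 σ₁) ∧
      ∀ σ ∈ Ioo 0 σ₁,
        HasDerivAt (fun s : ℝ => x (t₀ + s / Rn))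
          (Rk / Rn * g (t₀ + σ / Rn) + (dx (t₀ + σ / Rn) - Rk * g (t₀ + σ / Rn)) / Rn) σ ∧
        |(dx (t₀ + σ / Rn) - Rk * g (t₀ + σ / Rn)) / Rn| ≤ η * (Rk / Rn) * M (t₀ + σ / Rn) := by
  intro x dx g M t₀ Rn Rk T σ₁ η hRn ht₀ hσ₁ hT hxc hdxc hgc hMc hode
  -- the time change maps [0,σ₁] into [0,T] and (0,σ₁) into (0,T)
  have hmap : ∀ σ ∈ Icc 0 σ₁, t₀ + σ / Rn ∈ Icc 0 T := by
    intro σ hσ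
    have h0 : 0 ≤ σ / Rn := div_nonneg hσ.1 hRn.le
    refine ⟨by linarith, ?_⟩
    have : σ / Rn ≤ σ₁ / Rn := div_le_div_of_nonneg_right hσ.2 hRn.le
    linarith
  have hmapo : ∀ σ ∈ Ioo 0 σ₁, t₀ + σ / Rn ∈ Ioo 0 T := by
    intro σ hσ
    refine ⟨by have := div_pos hσ.1 hRn; linarith, ?_⟩
    have : σ / Rn < σ₁ / Rn := div_lt_div_of_pos_right hσ.2 hRn
    linarith
  have hφ : Continuous fun σ : ℝ => t₀ + σ / Rn := by fun_prop
  have hmt : MapsTo (fun σ : ℝ => t₀ + σ / Rn) (Icc 0 σ₁) (Icc 0 T) := fun σ hσ => hmap σ hσ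
  refine ⟨hxc.comp hφ.continuousOn hmt, ?_, fun σ hσ => ⟨?_, ?_⟩⟩
  · exact ((hdxc.comp hφ.continuousOn hmt).sub ((hgc.comp hφ.continuousOn hmt).const_smul Rk |>.congr
      (fun σ _ => by simp [smul_eq_mul]))).div_const Rn
  · obtain ⟨hd, -⟩ := hode _ (hmapo σ hσ)
    have h1 : HasDerivAt (fun s : ℝ => x (t₀ + s / Rn)) (dx (t₀ + σ / Rn) / Rn) σ := by
      have hlin : HasDerivAt (fun s : ℝ => t₀ + s / Rn) (1 / Rn) σ := by
        simpa using ((hasDerivAt_id σ).div_const Rn).const_add t₀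
      have h2 := hd.comp σ hlin
      have heq : dx (t₀ + σ / Rn) * (1 / Rn) = dx (t₀ + σ / Rn) / Rn := by ring
      rw [heq] at h2
      exact h2
    have heq2 : dx (t₀ + σ / Rn) / Rn =
        Rk / Rn * g (t₀ + σ / Rn) + (dx (t₀ + σ / Rn) - Rk * g (t₀ + σ / Rn)) / Rn := by
      field_simp
      ring
    rw [heq2] at h1
    exact h1
  · obtain ⟨-, hb⟩ := hode _ (hmapo σ hσ)
    rw [abs_div, abs_of_pos hRn, div_le_iff₀ hRn]
    calc |dx (t₀ + σ / Rn) - Rk * g (t₀ + σ / Rn)| ≤ η * Rk * M (t₀ + σ / Rn) := hb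
      _ = η * (Rk / Rn) * M (t₀ + σ / Rn) * Rn := by field_simp

end Summit.NavierStokesRegularity.NavierStokesRegularity.Theorems.PerpetualPumpAveragedTypeIBlowup

end
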